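import Literature.Probability.RandomPlanarGeometry.SAWAdsorptionLowTemperatureSharp
import HarnessLib

/-!
# The low-temperature law of the adsorbing half-plane self-avoiding walk on `ℤ²`, exact second order:
# `a + 1/a ≤ e^{κ(a)} ≤ a + 1/a + 6/a²` (`a ≥ 6`), hence `a·(e^{κ(a)} − a) → 1` and `κ(α) = α + e^{−2α} + O(e^{−3α})`

Topic `Literature/Probability/RandomPlanarGeometry` (continues `SAWAdsorptionLowTemperature.lean` — the potential
method on no-reversal half-plane words, `a ≤ e^{κ(a)} ≤ a + 2` — and `SAWAdsorptionLowTemperatureSharp.lean` —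
`a + 1/a ≤ e^{κ(a)}` for `a ≥ 3`, `e^{κ(a)} ≤ a + 6/a`).

The no-reversal relaxation cannot see beyond `e^{κ(a)} ≤ a + (4+o(1))/a`: it admits two fake excursions of weight
`a⁻¹` relative to the wall run — «up, back over the run, down» and «back» after the minimal bump `+e₀ e −e₀` — and both
close a unit square. This file runs the same potential method on the sharper relaxation «no immediate reversal, no unit
4-cycle, non-negative heights», organised by a finite memory `LowTempMem.Mem` (ten tags recording the last letter and the
two relevant three-letter windows) next to the exact height:

* `LowTempMem.admM_of_saw` — every half-plane self-avoiding word is admissible for this rule from a `Good` configuration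
  (a reversal returns to the position two letters earlier, a window `x y x̄ ȳ` to the position four letters earlier);
* `LowTempMem.adsZ_le_of_potentialM` — any `Λ`-excessive potential `u ≥ δ` on `Good` configurations gives
  `Z⁺_n(a) ≤ Λⁿ u(0, S0)/δ` (the framework of the first file, with an invariant);
* `LowTempMem.locSumM_pot₃_le_poly` — the polynomial potential `LowTempMem.pot₃ a` is `(a + 1/a + 6/a²)`-excessive for
  `a ≥ 6`: twenty-two `Good` configurations, each a univariate polynomial inequality whose coefficients in `a − 6` are
  all non-negative (the binding ones: height one just after a step down, and the off-wall block at heights `2, 3`);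
* `Zd.adsZ_le_exact` — `Z⁺_n(a) ≤ 2a² (a + 1/a + 6/a²)ⁿ`; **`Zd.adsRate_le_add_inv_add_six_div_sq` — `e^{κ(a)} ≤ a + 1/a + 6/a²`
  for `a ≥ 6`**; `Zd.adsRate_mem_Icc_exact` — **`a + 1/a ≤ e^{κ(a)} ≤ a + 1/a + 6/a²`** (`a ≥ 6`);
* **`Zd.tendsto_mul_adsRate_sub_self` — `a·(e^{κ(a)} − a) → 1`**: the coefficient of `1/a` is exactly `1` (one family of
  excursions survives at this order — the unit bumps ahead of the wall run);
* `Zd.adsFreeEnergy_sub_mem_Icc_exact` — **`log(1 + e^{−2α}) ≤ κ(α) − α ≤ log(1 + e^{−2α} + 6e^{−3α})`** for `α ≥ log 6`.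

Status in print: first-order law `e^{κ(a)} ∼ a` on `ℤ²` = Rychlewski–Whittington 2011 as reported by
[cite: BeatonBousquetMelouDeGierDuminilCopinGuttmann2014, §3 (arXiv v5 pp. 9–10)] and [cite: BeatonGuttmannJensen2012Adsorption, p. 2];
ratio asymptotics [cite: JansevanRensburgWhittington2013, Corollary 1 and Theorem 5 (arXiv v4 p. 9)]; window
`a ≤ e^{κ} ≤ μa` [cite: JansevanRensburgWhittington2013, §3.1 eq. (3.1) (arXiv v4 p. 6)]. The second-order coefficient and
the two-sided envelope are not located in print (primary J. Stat. Phys. 145 (2011) 661–668 not held; label provisional,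
to be set by the lane's literature seat). Pure standard axioms. (Lane «pcv-sawmu», a-p3 g10.)
-/

noncomputable section

open Finset Filter Topology Literature.Probability.LatticeModels
open scoped BigOperators

namespace Literature.Probability.RandomPlanarGeometry.SAW.Zd

namespace LowTempMem

open LowTemp

/-! ### Local copies of word lemmas -/

/-- `traj (s :: w) (i+1) = vec s + traj w i`. [folklore] -/
private theorem traj_cons_succ (s : Step) (w : List Step) (i : ℕ) :
    traj (s :: w) (i + 1) = Step.vec s + traj w i := by
  simp only [traj, List.take_succ_cons, wEnd_cons]

/-- `vec (opp s) + vec s = 0`. [folklore] -/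
private theorem vec_opp_add (s : Step) : Step.vec (Step.opp s) + Step.vec s = 0 := by
  ext i
  fin_cases s <;> fin_cases i <;> simp [Step.opp, Step.vec, Step.dx, Step.dy]

/-- `vec s + vec (opp s) = 0`. [folklore] -/
private theorem vec_add_opp (s : Step) : Step.vec s + Step.vec (Step.opp s) = 0 := by
  rw [add_comm]; exact vec_opp_add s

/-- `opp (opp s) = s`. [folklore] -/
private theorem opp_opp (s : Step) : Step.opp (Step.opp s) = s := by
  fin_cases s <;> decide

/-- Words of length `n + 1` are `s :: w` with `w` of length `n`. [folklore] -/
private theorem words_succ_eq (n : ℕ) :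
    words (n + 1) = ((Finset.univ : Finset Step) ×ˢ words n).image fun p => p.1 :: p.2 := by
  ext w
  simp only [mem_words, Finset.mem_image, Finset.mem_product, Finset.mem_univ, true_and]
  constructor
  · intro h
    cases w with
    | nil => simp at h
    | cons st w => exact ⟨(st, w), by simpa using h, rfl⟩
  · rintro ⟨⟨st, w'⟩, hw', rfl⟩
    simpa using hw'

/-! ### The memory and the one-step rule -/

/-- The memory of the relaxation «no reversal, no unit square»: `S0` start; `R e` inside a wall run (last letter `e`);
`Lg` just landed; `L1 e` just landed closing the minimal bump `+e₀ e −e₀`; `U1 p` at height one right after leaving the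
wall, `p` the wall letter before (`none` at the start); `Hs e` window `+e₀ e` at height one; `Ho e` window `ē +e₀ e` at
height one (hovering back over the run); `U`/`H e`/`D` off the wall with last letter up / horizontal `e` / down.
[cite: BeatonGuttmannJensen2012Adsorption, §1 (p. 2)] -/
inductive Mem
  | S0 : Mem
  | R : Step → Mem
  | Lg : Mem
  | L1 : Step → Mem
  | U1 : Option Step → Mem
  | Hs : Step → Mem
  | Ho : Step → Mem
  | U : Mem
  | H : Step → Mem
  | D : Mem
  deriving DecidableEq

namespace Mem

/-- The last letter recorded by the memory. [cite: BeatonGuttmannJensen2012Adsorption, §1 (p. 2)] -/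
def last : Mem → Option Step
  | S0 => none
  | R e => some e
  | Lg => some 2
  | L1 _ => some 2
  | U1 _ => some 0
  | Hs e => some e
  | Ho e => some e
  | U => some 0
  | H e => some e
  | D => some 2

/-- The letter that would close a unit square: `ē` after the bump `+e₀ e −e₀`, and `−e₀` after `ē +e₀ e`.
[cite: BeatonGuttmannJensen2012Adsorption, §1 (p. 2)] -/
def cyc : Mem → Option Step
  | L1 e => some (Step.opp e)
  | Ho _ => some 2
  | _ => none

/-- Memory update on reading the letter `s` at height `h` (before the step). [cite: BeatonGuttmannJensen2012Adsorption, §1 (p. 2)] -/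
def push (h : ℤ) (m : Mem) (s : Step) : Mem :=
  if s = 0 then
    (if h = 0 then (match m with | R e => U1 (some e) | _ => U1 none) else U)
  else if s = 2 then
    (if h = 1 then (match m with | Hs e => L1 e | _ => Lg) else D)
  else if h = 0 then R s
  else match m with
    | U1 (some d) => if s = Step.opp d then Ho s else Hs s
    | U1 none => Hs s
    | _ => H s

end Mem

open Mem

/-- A letter `s` may follow memory `m` at height `h`: no reversal, no step into the wall, no unit square.
[cite: BeatonGuttmannJensen2012Adsorption, §1 (p. 2)] -/
def AllowedM (h : ℤ) (m : Mem) (s : Step) : Prop :=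
  m.last ≠ some (Step.opp s) ∧ (s = 2 → 1 ≤ h) ∧ m.cyc ≠ some s

/-- `AllowedM` is decidable. [folklore] -/
instance (h : ℤ) (m : Mem) (s : Step) : Decidable (AllowedM h m s) := by
  unfold AllowedM; infer_instance

/-- Admissible words from the configuration `(h, m)`. [cite: BeatonGuttmannJensen2012Adsorption, §1 (p. 2)] -/
def AdmM : ℤ → Mem → List Step → Prop
  | _, _, [] => True
  | h, m, s :: w => AllowedM h m s ∧ AdmM (h + s.dx) (m.push h s) w

/-- `AdmM` is decidable. [folklore] -/
instance decAdmM : ∀ (h : ℤ) (m : Mem) (w : List Step), Decidable (AdmM h m w)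
  | _, _, [] => isTrue trivial
  | h, m, s :: w =>
    haveI := decAdmM (h + s.dx) (m.push h s) w
    inferInstanceAs (Decidable (AllowedM h m s ∧ AdmM (h + s.dx) (m.push h s) w))

/-- Potential-weighted weight of a word (arrival weight `wt a` of the previous file). [cite: BeatonGuttmannJensen2012Adsorption, §1 (p. 2)] -/
def valM (u : ℤ → Mem → ℝ) (a : ℝ) : ℤ → Mem → List Step → ℝ
  | h, m, [] => u h m
  | h, m, s :: w => wt a (h + s.dx) * valM u a (h + s.dx) (m.push h s) w

/-- `valM` on admissible words, zero otherwise. [cite: BeatonGuttmannJensen2012Adsorption, §1 (p. 2)] -/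
def FM (u : ℤ → Mem → ℝ) (a : ℝ) (h : ℤ) (m : Mem) (w : List Step) : ℝ :=
  if AdmM h m w then valM u a h m w else 0

/-- One-step potential sum. [cite: BeatonGuttmannJensen2012Adsorption, §1 (p. 2)] -/
def locSumM (u : ℤ → Mem → ℝ) (a : ℝ) (h : ℤ) (m : Mem) : ℝ :=
  ∑ s : Step, if AllowedM h m s then wt a (h + s.dx) * u (h + s.dx) (m.push h s) else 0

/-- Horizontal letters `±e₁` (the wall directions). [cite: BeatonGuttmannJensen2012Adsorption, §1 (p. 2)] -/
def Horz (e : Step) : Prop := e = 1 ∨ e = 3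

/-- The invariant of reachable configurations: wall tags at height `0`, first-excursion-step tags at height `1`, `U` at
height `≥ 2`, `H`/`D` at height `≥ 1`; recorded side letters horizontal. [cite: BeatonGuttmannJensen2012Adsorption, §1 (p. 2)] -/
def Good (h : ℤ) : Mem → Prop
  | S0 => h = 0
  | R e => h = 0 ∧ Horz e
  | Lg => h = 0
  | L1 e => h = 0 ∧ Horz e
  | U1 p => h = 1 ∧ ∀ d, p = some d → Horz d
  | Hs e => h = 1 ∧ Horz e
  | Ho e => h = 1 ∧ Horz e
  | U => 2 ≤ h
  | H e => 1 ≤ h ∧ Horz e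
  | D => 1 ≤ h

/-- `Good` is preserved along allowed letters. [cite: BeatonGuttmannJensen2012Adsorption, §1 (p. 2)] -/
theorem good_push {h : ℤ} {m : Mem} {s : Step} (hg : Good h m) (ha : AllowedM h m s) :
    Good (h + s.dx) (m.push h s) := by
  rcases ha with ⟨h1, h2, h3⟩
  rcases m with _ | e | _ | e | p | e | e | _ | e | _
  · have hh : h = 0 := hg
    subst hh
    fin_cases s <;> simp [Mem.push, Good, Horz, Step.dx, Step.opp, Mem.last, Mem.cyc] at h1 h2 h3 ⊢
  · obtain ⟨hh, he⟩ := hg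
    subst hh
    fin_cases s <;> simp [Mem.push, Good, Horz, Step.dx, Step.opp, Mem.last, Mem.cyc] at h1 h2 h3 ⊢
    simpa [Horz] using he
  · have hh : h = 0 := hg
    subst hh
    fin_cases s <;> simp [Mem.push, Good, Horz, Step.dx, Step.opp, Mem.last, Mem.cyc] at h1 h2 h3 ⊢
  · obtain ⟨hh, he⟩ := hg
    subst hh
    fin_cases s <;> simp [Mem.push, Good, Horz, Step.dx, Step.opp, Mem.last, Mem.cyc] at h1 h2 h3 ⊢
  · obtain ⟨hh, hp⟩ := hg
    subst hh
    rcases p with _ | d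
    · fin_cases s <;> simp [Mem.push, Good, Horz, Step.dx, Step.opp, Mem.last, Mem.cyc] at h1 h2 h3 ⊢
    · have hd : Horz d := hp d rfl
      fin_cases s <;> simp [Mem.push, Good, Horz, Step.dx, Step.opp, Mem.last, Mem.cyc] at h1 h2 h3 ⊢ <;>
        split_ifs <;> simp
  · obtain ⟨hh, he⟩ := hg
    subst hh
    fin_cases s <;> simp [Mem.push, Good, Horz, Step.dx, Step.opp, Mem.last, Mem.cyc] at h1 h2 h3 ⊢
    exact he
  · obtain ⟨hh, he⟩ := hg
    subst hh
    fin_cases s <;> simp [Mem.push, Good, Horz, Step.dx, Step.opp, Mem.last, Mem.cyc] at h1 h2 h3 ⊢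
  · have hU : (2 : ℤ) ≤ h := hg
    have h0 : h ≠ 0 := by omega
    have h1' : h ≠ 1 := by omega
    fin_cases s
    · simp [Mem.push, Good, Step.dx, h0]; omega
    · simp [Mem.push, Good, Horz, Step.dx, h0]; omega
    · simp [Mem.push, Good, Step.dx, h1']; omega
    · simp [Mem.push, Good, Horz, Step.dx, h0]; omega
  · obtain ⟨hH, he⟩ := hg
    have h0 : h ≠ 0 := by omega
    by_cases h1' : h = 1
    · subst h1'
      fin_cases s <;> simp [Mem.push, Good, Horz, Step.dx, Step.opp, Mem.last, Mem.cyc] at h1 h2 h3 ⊢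
    · fin_cases s
      · simp [Mem.push, Good, Step.dx, h0]; omega
      · simp [Mem.push, Good, Horz, Step.dx, h0]; omega
      · simp [Mem.push, Good, Step.dx, h1']; omega
      · simp [Mem.push, Good, Horz, Step.dx, h0]; omega
  · have hD : (1 : ℤ) ≤ h := hg
    have h0 : h ≠ 0 := by omega
    by_cases h1' : h = 1
    · subst h1'
      fin_cases s <;> simp [Mem.push, Good, Horz, Step.dx, Step.opp, Mem.last, Mem.cyc] at h1 h2 h3 ⊢
    · fin_cases s
      · simp [Mem.last, Step.opp] at h1
      · simp [Mem.push, Good, Horz, Step.dx, h0]; omega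
      · simp [Mem.push, Good, Step.dx, h1']; omega
      · simp [Mem.push, Good, Horz, Step.dx, h0]; omega

/-! ### The bridge: half-plane self-avoiding words are admissible -/

/-- What the memory asserts about the letters `p` read so far (the windows used to reject letters). [cite: BeatonGuttmannJensen2012Adsorption, §1 (p. 2)] -/
def Rel : Mem → List Step → Prop
  | S0, p => p = []
  | R e, p => ∃ q, p = q ++ [e]
  | Lg, p => ∃ q, p = q ++ [2]
  | L1 e, p => ∃ q, p = q ++ [0, e, 2]
  | U1 none, p => p = [0]
  | U1 (some d), p => ∃ q, p = q ++ [d, 0]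
  | Hs e, p => ∃ q, p = q ++ [0, e]
  | Ho e, p => ∃ q, p = q ++ [Step.opp e, 0, e]
  | U, p => ∃ q, p = q ++ [0]
  | H e, p => ∃ q, p = q ++ [e]
  | D, p => ∃ q, p = q ++ [2]

/-- The recorded last letter is the last letter read. [folklore] -/
private theorem rel_last {m : Mem} {p : List Step} (hr : Rel m p) {t : Step} (ht : m.last = some t) :
    ∃ q, p = q ++ [t] := by
  rcases m with _ | e | _ | e | p' | e | e | _ | e | _ <;>
    simp only [Mem.last, Option.some.injEq, reduceCtorEq] at ht <;> subst ht
  · exact hr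
  · exact hr
  · obtain ⟨q, rfl⟩ := hr; exact ⟨q ++ [0, e], by simp⟩
  · rcases p' with _ | d
    · exact ⟨[], by simpa [Rel] using hr⟩
    · obtain ⟨q, rfl⟩ := hr; exact ⟨q ++ [d], by simp⟩
  · obtain ⟨q, rfl⟩ := hr; exact ⟨q ++ [0], by simp⟩
  · obtain ⟨q, rfl⟩ := hr; exact ⟨q ++ [Step.opp e, 0], by simp⟩
  · exact hr
  · exact hr
  · exact hr

/-- A rejected «unit square» letter would close the window `x y x̄` by `ȳ`. [folklore] -/
private theorem rel_cyc {m : Mem} {p : List Step} (hr : Rel m p) {s : Step} (hs : m.cyc = some s) :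
    ∃ q x y, p = q ++ [x, y, Step.opp x] ∧ s = Step.opp y := by
  rcases m with _ | e | _ | e | p' | e | e | _ | e | _ <;>
    simp only [Mem.cyc, Option.some.injEq, reduceCtorEq] at hs <;> subst hs
  · obtain ⟨q, rfl⟩ := hr
    exact ⟨q, 0, e, by simp [Step.opp], rfl⟩
  · obtain ⟨q, rfl⟩ := hr
    exact ⟨q, Step.opp e, 0, by simp, by decide⟩

/-- The memory update keeps `Rel` (at a `Good` configuration, along an allowed letter). [folklore] -/
private theorem rel_push {h : ℤ} {m : Mem} {p : List Step} {s : Step} (hg : Good h m) (ha : AllowedM h m s)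
    (hr : Rel m p) : Rel (m.push h s) (p ++ [s]) := by
  rcases ha with ⟨h1, -, -⟩
  -- case on the letter
  by_cases hs0 : s = 0
  · subst hs0
    by_cases hh : h = 0
    · subst hh
      rcases m with _ | e | _ | e | p' | e | e | _ | e | _ <;>
        simp [Good, Mem.last, Step.opp] at hg h1 <;> simp [Mem.push, Rel]
      · simpa [Rel] using hr
      · obtain ⟨q, rfl⟩ := hr; exact ⟨q, by simp⟩
    · simp [Mem.push, hh, Rel]
  by_cases hs2 : s = 2
  · subst hs2
    by_cases hh : h = 1
    · subst hh
      rcases m with _ | e | _ | e | p' | e | e | _ | e | _ <;> simp [Mem.push, Rel]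
      obtain ⟨q, rfl⟩ := hr; exact ⟨q, by simp⟩
    · simp [Mem.push, hh, Rel]
  -- horizontal letter
  by_cases hh : h = 0
  · subst hh; simp [Mem.push, hs0, hs2, Rel]
  rcases m with _ | e | _ | e | p' | e | e | _ | e | _ <;> simp [Mem.push, hs0, hs2, hh, Rel]
  rcases p' with _ | d
  · have hp : p = [0] := hr
    exact ⟨[], by simp [hp]⟩
  · obtain ⟨q, rfl⟩ := hr
    simp only
    split_ifs with hsd
    · subst hsd; exact ⟨q, by simp⟩
    · exact ⟨q ++ [d], by simp⟩

/-- **Every half-plane self-avoiding word is admissible**: from a `Good` configuration `(h, m)` related to the letters `p`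
already read, a word `w` with non-negative heights and `p ++ w` self-avoiding is `AdmM h m w` (a reversal returns to
the position two letters back, a unit square four letters back). [cite: BeatonGuttmannJensen2012Adsorption, §1 (p. 2)] -/
theorem admM_of_saw : ∀ (w : List Step) (h : ℤ) (m : Mem) (p : List Step), Good h m → Rel m p →
    (∀ i ≤ w.length, 0 ≤ h + traj w i 0) → IsSAW (p ++ w) → AdmM h m w
  | [], _, _, _, _, _, _, _ => trivial
  | s :: w, h, m, p, hg, hr, hh, hsaw => by
    have hal : AllowedM h m s := by
      refine ⟨?_, ?_, ?_⟩
      · intro ht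
        obtain ⟨q, rfl⟩ := rel_last hr ht
        have hsaw' : IsSAW (Step.opp s :: s :: w) := by
          have := hsaw.drop q.length
          simpa using this
        have hinj := (isSAW_iff_injOn _).1 hsaw'
        have h02 : traj (Step.opp s :: s :: w) 0 = traj (Step.opp s :: s :: w) 2 := by
          rw [traj_zero, traj_cons_succ, traj_cons_succ, traj_zero, add_zero, vec_opp_add]
        exact absurd (hinj (by simp) (by simp) h02) (by norm_num)
      · intro hs2
        subst hs2
        have := hh 1 (by simp)
        rw [traj_cons_succ, traj_zero, add_zero] at this
        simp [Step.dx] at this ⊢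
        linarith
      · intro hc
        obtain ⟨q, x, y, rfl, rfl⟩ := rel_cyc hr hc
        have hsaw' : IsSAW (x :: y :: Step.opp x :: Step.opp y :: w) := by
          have := hsaw.drop q.length
          simpa using this
        have hinj := (isSAW_iff_injOn _).1 hsaw'
        have h04 : traj (x :: y :: Step.opp x :: Step.opp y :: w) 0 =
            traj (x :: y :: Step.opp x :: Step.opp y :: w) 4 := by
          rw [traj_zero, traj_cons_succ, traj_cons_succ, traj_cons_succ, traj_cons_succ, traj_zero, add_zero,
            ← add_assoc, ← add_assoc]
          have e1 : Step.vec x + Step.vec y + Step.vec (Step.opp x) = Step.vec y := by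
            rw [add_comm (Step.vec x), add_assoc, vec_add_opp, add_zero]
          rw [e1, vec_add_opp]
        exact absurd (hinj (by simp) (by simp) h04) (by norm_num)
    refine ⟨hal, admM_of_saw w (h + s.dx) (m.push h s) (p ++ [s]) (good_push hg hal) (rel_push hg hal hr)
      (fun i hi => ?_) (by simpa using hsaw)⟩
    have := hh (i + 1) (by simpa using hi)
    rwa [traj_cons_succ, Pi.add_apply, Step.vec_apply_zero, ← add_assoc] at this

/-! ### Potential-weighted sums with the invariant -/

/-- `wt ≥ 0`. [folklore] -/
private theorem wt_nonneg' {a : ℝ} (ha : 0 ≤ a) (h : ℤ) : 0 ≤ wt a h := by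
  unfold wt; split_ifs
  · exact ha
  · exact zero_le_one

/-- `valM ≥ 0` for `u ≥ 0`. [folklore] -/
private theorem valM_nonneg {u : ℤ → Mem → ℝ} (hu : ∀ h m, 0 ≤ u h m) {a : ℝ} (ha : 0 ≤ a) :
    ∀ (w : List Step) (h : ℤ) (m : Mem), 0 ≤ valM u a h m w
  | [], h, m => hu h m
  | _ :: w, _, _ => mul_nonneg (wt_nonneg' ha _) (valM_nonneg hu ha w _ _)

/-- `FM ≥ 0`. [folklore] -/
private theorem FM_nonneg {u : ℤ → Mem → ℝ} (hu : ∀ h m, 0 ≤ u h m) {a : ℝ} (ha : 0 ≤ a)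
    (h : ℤ) (m : Mem) (w : List Step) : 0 ≤ FM u a h m w := by
  unfold FM; split_ifs
  · exact valM_nonneg hu ha w h m
  · exact le_rfl

/-- First-letter recursion for `FM`. [folklore] -/
private theorem FM_cons (u : ℤ → Mem → ℝ) (a : ℝ) (h : ℤ) (m : Mem) (s : Step) (w : List Step) :
    FM u a h m (s :: w) = if AllowedM h m s then wt a (h + s.dx) * FM u a (h + s.dx) (m.push h s) w else 0 := by
  unfold FM
  simp only [AdmM, valM]
  by_cases h1 : AllowedM h m s <;> by_cases h2 : AdmM (h + s.dx) (m.push h s) w <;> simp [h1, h2]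

/-- **The potential bound with invariant**: if `u ≥ 0` is `Λ`-excessive at every `Good` configuration then the
potential-weighted sum over admissible words of length `n` from a `Good` configuration is at most `Λⁿ u`.
[cite: BeatonGuttmannJensen2012Adsorption, §1 (p. 2)] -/
theorem sum_words_le_of_good {u : ℤ → Mem → ℝ} {a Λ : ℝ} (ha : 0 ≤ a) (hΛ : 0 ≤ Λ)
    (hloc : ∀ h m, Good h m → locSumM u a h m ≤ Λ * u h m) :
    ∀ (n : ℕ) (h : ℤ) (m : Mem), Good h m → ∑ w ∈ words n, FM u a h m w ≤ Λ ^ n * u h m := by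
  classical
  intro n
  induction n with
  | zero =>
    intro h m _
    have h0 : words 0 = {[]} := by
      ext w; simp only [mem_words, Finset.mem_singleton, List.length_eq_zero_iff]
    simp [h0, FM, AdmM, valM]
  | succ n ih =>
    intro h m hg
    rw [words_succ_eq, Finset.sum_image, Finset.sum_product]
    · calc ∑ s : Step, ∑ w ∈ words n, FM u a h m (s :: w)
            = ∑ s : Step, (if AllowedM h m s then wt a (h + s.dx) else 0) *
                ∑ w ∈ words n, FM u a (h + s.dx) (m.push h s) w := by
              refine Finset.sum_congr rfl fun s _ => ?_
              rw [Finset.mul_sum]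
              refine Finset.sum_congr rfl fun w _ => ?_
              rw [FM_cons]
              split_ifs <;> simp
        _ ≤ ∑ s : Step, (if AllowedM h m s then wt a (h + s.dx) else 0) *
                (Λ ^ n * u (h + s.dx) (m.push h s)) := by
              refine Finset.sum_le_sum fun s _ => ?_
              by_cases hs : AllowedM h m s
              · rw [if_pos hs]
                exact mul_le_mul_of_nonneg_left (ih _ _ (good_push hg hs)) (wt_nonneg' ha _)
              · rw [if_neg hs, zero_mul, zero_mul]
        _ = Λ ^ n * locSumM u a h m := by
              rw [locSumM, Finset.mul_sum]
              refine Finset.sum_congr rfl fun s _ => ?_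
              split_ifs <;> ring
        _ ≤ Λ ^ n * (Λ * u h m) := mul_le_mul_of_nonneg_left (hloc h m hg) (pow_nonneg hΛ n)
        _ = Λ ^ (n + 1) * u h m := by ring
    · rintro ⟨st, w⟩ _ ⟨st', w'⟩ _ hp
      simp only [List.cons.injEq] at hp
      exact Prod.ext hp.1 hp.2

/-- First-letter recursion for `LowTemp.zc`. [folklore] -/
private theorem zc_cons' (h : ℤ) (s : Step) (w : List Step) :
    zc h (s :: w) = (if h + s.dx = 0 then 1 else 0) + zc (h + s.dx) w := by
  unfold zc
  rw [List.length_cons, Finset.sum_range_succ']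
  simp only [traj_cons_succ, Pi.add_apply, Step.vec_apply_zero, traj_zero, Pi.zero_apply, add_zero, ← add_assoc]
  exact add_comm _ _

/-- `valM = a^{#wall times} · u(final)` and the final configuration is `Good` along admissible words. [folklore] -/
private theorem valM_ge : ∀ (w : List Step) (h : ℤ) (m : Mem) {u : ℤ → Mem → ℝ} {a δ : ℝ},
    0 ≤ a → (∀ h m, Good h m → δ ≤ u h m) → Good h m → AdmM h m w → δ * a ^ zc h w ≤ valM u a h m w
  | [], h, m, u, a, δ, _, hu, hg, _ => by simpa [valM, zc] using hu h m hg
  | s :: w, h, m, u, a, δ, ha, hu, hg, hadm => by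
    obtain ⟨hal, hadm'⟩ := hadm
    rw [valM, zc_cons', pow_add]
    have ih := valM_ge w (h + s.dx) (m.push h s) ha hu (good_push hg hal) hadm'
    have hwt : wt a (h + s.dx) = a ^ (if h + s.dx = 0 then 1 else 0) := by
      unfold wt; split_ifs <;> simp
    rw [hwt]
    calc δ * (a ^ (if h + s.dx = 0 then 1 else 0) * a ^ zc (h + s.dx) w)
        = a ^ (if h + s.dx = 0 then 1 else 0) * (δ * a ^ zc (h + s.dx) w) := by ring
      _ ≤ a ^ (if h + s.dx = 0 then 1 else 0) * valM u a (h + s.dx) (m.push h s) w :=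
        mul_le_mul_of_nonneg_left ih (pow_nonneg ha _)

/-- `zc 0 w = wallVisits |w| (traj w)`. [folklore] -/
private theorem zc_zero_eq_wallVisits' {n : ℕ} {w : List Step} (hl : w.length = n) :
    zc 0 w = wallVisits n (traj w) := by
  classical
  unfold zc wallVisits
  rw [Finset.card_filter, Finset.sum_range_succ', hl]
  simp

/-- **`Z⁺_n(a) ≤ Λⁿ · u(0, S0) / δ`** for every potential `u ≥ δ > 0` on `Good` configurations that is `Λ`-excessive
for the rule «no reversal, no unit square». [cite: BeatonGuttmannJensen2012Adsorption, §1 (p. 2)] -/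
theorem adsZ_le_of_potentialM (u : ℤ → Mem → ℝ) {a Λ δ : ℝ} (ha : 0 ≤ a) (hΛ : 0 ≤ Λ) (hδ : 0 < δ)
    (hu : ∀ h m, Good h m → δ ≤ u h m) (hu0 : ∀ h m, 0 ≤ u h m)
    (hloc : ∀ h m, Good h m → locSumM u a h m ≤ Λ * u h m) (n : ℕ) :
    adsZ n a ≤ Λ ^ n * u 0 S0 / δ := by
  classical
  set good : Finset (List Step) := (sawWords n).filter (fun w => ∀ i ≤ n, 0 ≤ traj w i 0) with hgood
  have himage : hpWalks n = good.image traj := by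
    ext ω
    simp only [mem_hpWalks, Finset.mem_image, hgood, Finset.mem_filter, mem_sawWords]
    constructor
    · rintro ⟨hω, hhp⟩
      have hω' : ω ∈ (sawWords n).image traj := by rw [image_traj_sawWords]; exact hω
      obtain ⟨w, hw, rfl⟩ := Finset.mem_image.1 hω'
      exact ⟨w, ⟨mem_sawWords.1 hw, hhp⟩, rfl⟩
    · rintro ⟨w, ⟨⟨hl, hs⟩, hhp⟩, rfl⟩
      exact ⟨traj_mem_saws hl hs, hhp⟩
  have hmem : ∀ w ∈ good, (w.length = n ∧ IsSAW w) ∧ ∀ i ≤ n, 0 ≤ traj w i 0 := fun w hw => by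
    simpa [hgood] using hw
  have hinj : Set.InjOn traj (good : Set (List Step)) := fun w hw w' hw' h =>
    traj_injOn n (by simp [(hmem w hw).1.1]) (by simp [(hmem w' hw').1.1]) h
  rw [adsZ, himage, Finset.sum_image hinj]
  have hterm : ∀ w ∈ good, a ^ wallVisits n (traj w) ≤ FM u a 0 S0 w / δ := by
    intro w hw
    obtain ⟨⟨hl, hs⟩, hhp⟩ := hmem w hw
    have hadm : AdmM 0 S0 w :=
      admM_of_saw w 0 S0 [] rfl rfl (by simpa [hl] using hhp) (by simpa using hs)
    rw [FM, if_pos hadm, ← zc_zero_eq_wallVisits' hl, le_div_iff₀ hδ, mul_comm]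
    exact valM_ge w 0 S0 ha hu rfl hadm
  have hsub : good ⊆ words n := fun w hw => mem_words.2 (hmem w hw).1.1
  calc ∑ w ∈ good, a ^ wallVisits n (traj w) ≤ ∑ w ∈ good, FM u a 0 S0 w / δ := Finset.sum_le_sum hterm
    _ ≤ ∑ w ∈ words n, FM u a 0 S0 w / δ :=
        Finset.sum_le_sum_of_subset_of_nonneg hsub fun w _ _ => div_nonneg (FM_nonneg hu0 ha _ _ _) hδ.le
    _ = (∑ w ∈ words n, FM u a 0 S0 w) / δ := by rw [Finset.sum_div]
    _ ≤ Λ ^ n * u 0 S0 / δ := by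
        gcongr
        exact sum_words_le_of_good ha hΛ hloc n 0 S0 rfl

/-! ### The potential for the rule «no reversal, no unit square» -/

/-- The potential (polynomial normalisation, `× a³`): wall run `a³`, start `2a³`, landed `2a³ − 2a`, landed after the
minimal bump `a³`; at height one: just up `a² + 6a` (`2a² + 4a + 8` from the start), window `+e₀ e` `a³ + 2a² + a`,
window `ē +e₀ e` `2a² + 2a + 6`, other horizontal `2a³ + 2a²`, just down `2a³ + 4a²`; higher: up `8a`, horizontal
`2a² + 8a`, down `3a² + 4a`. [cite: BeatonGuttmannJensen2012Adsorption, §1 (p. 2)] -/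
def pot₃ (a : ℝ) (h : ℤ) : Mem → ℝ
  | S0 => 2 * a ^ 3
  | R _ => a ^ 3
  | Lg => 2 * a ^ 3 - 2 * a
  | L1 _ => a ^ 3
  | U1 none => 2 * a ^ 2 + 4 * a + 8
  | U1 (some _) => a ^ 2 + 6 * a
  | Hs _ => a ^ 3 + 2 * a ^ 2 + a
  | Ho _ => 2 * a ^ 2 + 2 * a + 6
  | U => 8 * a
  | H _ => if h = 1 then 2 * a ^ 3 + 2 * a ^ 2 else 2 * a ^ 2 + 8 * a
  | D => if h = 1 then 2 * a ^ 3 + 4 * a ^ 2 else 3 * a ^ 2 + 4 * a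

/-- `pot₃ ≥ a` on `Good` configurations (`a ≥ 6`). [folklore] -/
private theorem le_pot₃ {a : ℝ} (ha : 6 ≤ a) {h : ℤ} {m : Mem} (hg : Good h m) : a ≤ pot₃ a h m := by
  have h2 : a ≤ a ^ 2 := by nlinarith
  have h3 : a ≤ a ^ 3 := by nlinarith
  rcases m with _ | e | _ | e | p | e | e | _ | e | _ <;> (try rcases p with _ | d) <;> simp only [pot₃] <;>
    (try split_ifs) <;> nlinarith

/-- `pot₃ ≥ 0` (`a ≥ 6`), on every configuration. [folklore] -/
private theorem pot₃_nonneg {a : ℝ} (ha : 6 ≤ a) (h : ℤ) (m : Mem) : 0 ≤ pot₃ a h m := by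
  have h2 : a ≤ a ^ 2 := by nlinarith
  have h3 : a ≤ a ^ 3 := by nlinarith
  rcases m with _ | e | _ | e | p | e | e | _ | e | _ <;> (try rcases p with _ | d) <;> simp only [pot₃] <;>
    (try split_ifs) <;> nlinarith

/-- **The potential `pot₃ a` is `(a + 1/a + 6/a²)`-excessive on `Good` configurations for `a ≥ 6`** (polynomial form:
`a² · locSum ≤ (a³ + a + 6) · pot₃`): twenty-two configurations, each a univariate polynomial inequality with
non-negative coefficients in `a − 6`. [cite: BeatonGuttmannJensen2012Adsorption, §1 (p. 2)] -/
theorem locSumM_pot₃_le_poly {a : ℝ} (ha : 6 ≤ a) {h : ℤ} {m : Mem} (hg : Good h m) :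
    locSumM (pot₃ a) a h m * a ^ 2 ≤ (a ^ 3 + a + 6) * pot₃ a h m := by
  obtain ⟨b, hb, rfl⟩ : ∃ b : ℝ, 0 ≤ b ∧ a = b + 6 := ⟨a - 6, by linarith, by ring⟩
  rcases m with _ | e | _ | e | p | e | e | _ | e | _
  · -- S0
    have hh : h = 0 := hg
    subst hh
    simp [locSumM, Fin.sum_univ_four, AllowedM, Mem.push, Mem.last, Mem.cyc, wt, pot₃, Step.dx, Step.opp]
    ring_nf
    nlinarith [hb, pow_nonneg hb 2, pow_nonneg hb 3, pow_nonneg hb 4, pow_nonneg hb 5, pow_nonneg hb 6, pow_nonneg hb 7]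
  · -- R e
    obtain ⟨hh, he⟩ := hg
    subst hh
    rcases he with rfl | rfl <;> simp [locSumM, Fin.sum_univ_four, AllowedM, Mem.push, Mem.last, Mem.cyc, wt, pot₃, Step.dx, Step.opp] <;> ring_nf <;> nlinarith [hb, pow_nonneg hb 2, pow_nonneg hb 3, pow_nonneg hb 4, pow_nonneg hb 5, pow_nonneg hb 6, pow_nonneg hb 7]
  · -- Lg
    have hh : h = 0 := hg
    subst hh
    simp [locSumM, Fin.sum_univ_four, AllowedM, Mem.push, Mem.last, Mem.cyc, wt, pot₃, Step.dx, Step.opp]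
    ring_nf
    nlinarith [hb, pow_nonneg hb 2, pow_nonneg hb 3, pow_nonneg hb 4, pow_nonneg hb 5, pow_nonneg hb 6, pow_nonneg hb 7]
  · -- L1 e
    obtain ⟨hh, he⟩ := hg
    subst hh
    rcases he with rfl | rfl <;> simp [locSumM, Fin.sum_univ_four, AllowedM, Mem.push, Mem.last, Mem.cyc, wt, pot₃, Step.dx, Step.opp] <;> ring_nf <;> nlinarith [hb, pow_nonneg hb 2, pow_nonneg hb 3, pow_nonneg hb 4, pow_nonneg hb 5, pow_nonneg hb 6, pow_nonneg hb 7]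
  · -- U1 p
    obtain ⟨hh, hp⟩ := hg
    subst hh
    rcases p with _ | d
    · simp [locSumM, Fin.sum_univ_four, AllowedM, Mem.push, Mem.last, Mem.cyc, wt, pot₃, Step.dx, Step.opp]
      ring_nf
      nlinarith [hb, pow_nonneg hb 2, pow_nonneg hb 3, pow_nonneg hb 4, pow_nonneg hb 5, pow_nonneg hb 6, pow_nonneg hb 7]
    · have hd : Horz d := hp d rfl
      rcases hd with rfl | rfl <;> simp [locSumM, Fin.sum_univ_four, AllowedM, Mem.push, Mem.last, Mem.cyc, wt, pot₃, Step.dx, Step.opp] <;> ring_nf <;> nlinarith [hb, pow_nonneg hb 2, pow_nonneg hb 3, pow_nonneg hb 4, pow_nonneg hb 5, pow_nonneg hb 6, pow_nonneg hb 7]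
  · -- Hs e
    obtain ⟨hh, he⟩ := hg
    subst hh
    rcases he with rfl | rfl <;> simp [locSumM, Fin.sum_univ_four, AllowedM, Mem.push, Mem.last, Mem.cyc, wt, pot₃, Step.dx, Step.opp] <;> ring_nf <;> nlinarith [hb, pow_nonneg hb 2, pow_nonneg hb 3, pow_nonneg hb 4, pow_nonneg hb 5, pow_nonneg hb 6, pow_nonneg hb 7]
  · -- Ho e
    obtain ⟨hh, he⟩ := hg
    subst hh
    rcases he with rfl | rfl <;> simp [locSumM, Fin.sum_univ_four, AllowedM, Mem.push, Mem.last, Mem.cyc, wt, pot₃, Step.dx, Step.opp] <;> ring_nf <;> nlinarith [hb, pow_nonneg hb 2, pow_nonneg hb 3, pow_nonneg hb 4, pow_nonneg hb 5, pow_nonneg hb 6, pow_nonneg hb 7]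
  · -- U, h ≥ 2
    have hU : (2 : ℤ) ≤ h := hg
    have h0 : h ≠ 0 := by omega
    have h1 : h ≠ 1 := by omega
    have h1' : h + 1 ≠ 0 := by omega
    simp [locSumM, Fin.sum_univ_four, AllowedM, Mem.push, Mem.last, Mem.cyc, wt, pot₃, Step.dx, Step.opp,
      h0, h1, h1']
    ring_nf
    nlinarith [hb, pow_nonneg hb 2, pow_nonneg hb 3, pow_nonneg hb 4, pow_nonneg hb 5, pow_nonneg hb 6, pow_nonneg hb 7]
  · -- H e
    obtain ⟨hH, he⟩ := hg
    rcases (show h = 1 ∨ h = 2 ∨ 3 ≤ h by omega) with rfl | rfl | h3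
    · rcases he with rfl | rfl <;> simp [locSumM, Fin.sum_univ_four, AllowedM, Mem.push, Mem.last, Mem.cyc, wt, pot₃, Step.dx, Step.opp] <;> ring_nf <;> nlinarith [hb, pow_nonneg hb 2, pow_nonneg hb 3, pow_nonneg hb 4, pow_nonneg hb 5, pow_nonneg hb 6, pow_nonneg hb 7]
    · rcases he with rfl | rfl <;> simp [locSumM, Fin.sum_univ_four, AllowedM, Mem.push, Mem.last, Mem.cyc, wt, pot₃, Step.dx, Step.opp] <;> ring_nf <;> nlinarith [hb, pow_nonneg hb 2, pow_nonneg hb 3, pow_nonneg hb 4, pow_nonneg hb 5, pow_nonneg hb 6, pow_nonneg hb 7]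
    · have h0 : h ≠ 0 := by omega
      have h1 : h ≠ 1 := by omega
      have h1' : h + 1 ≠ 0 := by omega
      have hm0 : h + -1 ≠ 0 := by omega
      have hm1 : h + -1 ≠ 1 := by omega
      have hle : (1 : ℤ) ≤ h := by omega
      rcases he with rfl | rfl <;>
        simp [locSumM, Fin.sum_univ_four, AllowedM, Mem.push, Mem.last, Mem.cyc, wt, pot₃, Step.dx, Step.opp,
          h0, h1, h1', hm0, hm1, hle] <;> ring_nf <;> nlinarith [hb, pow_nonneg hb 2, pow_nonneg hb 3, pow_nonneg hb 4, pow_nonneg hb 5, pow_nonneg hb 6, pow_nonneg hb 7]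
  · -- D
    have hD : (1 : ℤ) ≤ h := hg
    rcases (show h = 1 ∨ h = 2 ∨ 3 ≤ h by omega) with rfl | rfl | h3
    · simp [locSumM, Fin.sum_univ_four, AllowedM, Mem.push, Mem.last, Mem.cyc, wt, pot₃, Step.dx, Step.opp]
      ring_nf
      nlinarith [hb, pow_nonneg hb 2, pow_nonneg hb 3, pow_nonneg hb 4, pow_nonneg hb 5, pow_nonneg hb 6, pow_nonneg hb 7]
    · simp [locSumM, Fin.sum_univ_four, AllowedM, Mem.push, Mem.last, Mem.cyc, wt, pot₃, Step.dx, Step.opp]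
      ring_nf
      nlinarith [hb, pow_nonneg hb 2, pow_nonneg hb 3, pow_nonneg hb 4, pow_nonneg hb 5, pow_nonneg hb 6, pow_nonneg hb 7]
    · have h0 : h ≠ 0 := by omega
      have h1 : h ≠ 1 := by omega
      have hm0 : h + -1 ≠ 0 := by omega
      have hm1 : h + -1 ≠ 1 := by omega
      have hle : (1 : ℤ) ≤ h := by omega
      simp [locSumM, Fin.sum_univ_four, AllowedM, Mem.push, Mem.last, Mem.cyc, wt, pot₃, Step.dx, Step.opp,
        h0, h1, hm0, hm1, hle]
      ring_nf
      nlinarith [hb, pow_nonneg hb 2, pow_nonneg hb 3, pow_nonneg hb 4, pow_nonneg hb 5, pow_nonneg hb 6, pow_nonneg hb 7]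

/-- The excessiveness in rate form: `locSum ≤ (a + 1/a + 6/a²) · pot₃` on `Good` configurations, `a ≥ 6`.
[cite: BeatonGuttmannJensen2012Adsorption, §1 (p. 2)] -/
theorem locSumM_pot₃_le {a : ℝ} (ha : 6 ≤ a) {h : ℤ} {m : Mem} (hg : Good h m) :
    locSumM (pot₃ a) a h m ≤ (a + 1 / a + 6 / a ^ 2) * pot₃ a h m := by
  have ha0 : 0 < a := by linarith
  have e : (a + 1 / a + 6 / a ^ 2) * pot₃ a h m = (a ^ 3 + a + 6) * pot₃ a h m / a ^ 2 := by
    field_simp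
  rw [e, le_div_iff₀ (by positivity)]
  exact locSumM_pot₃_le_poly ha hg

end LowTempMem

/-! ### The second-order upper bound and the exact coefficient -/

/-- **`Z⁺_n(a) ≤ 2a² (a + 1/a + 6/a²)ⁿ` for `a ≥ 6`.** [cite: BeatonGuttmannJensen2012Adsorption, §1 (p. 2)] -/
theorem adsZ_le_exact {a : ℝ} (ha : 6 ≤ a) (n : ℕ) : adsZ n a ≤ 2 * a ^ 2 * (a + 1 / a + 6 / a ^ 2) ^ n := by
  have ha0 : 0 < a := by linarith
  have h := LowTempMem.adsZ_le_of_potentialM (LowTempMem.pot₃ a) ha0.le (by positivity) ha0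
    (fun h m hg => LowTempMem.le_pot₃ ha hg) (fun h m => LowTempMem.pot₃_nonneg ha h m)
    (fun h m hg => LowTempMem.locSumM_pot₃_le ha hg) n
  calc adsZ n a ≤ (a + 1 / a + 6 / a ^ 2) ^ n * LowTempMem.pot₃ a 0 LowTempMem.Mem.S0 / a := h
    _ = 2 * a ^ 2 * (a + 1 / a + 6 / a ^ 2) ^ n := by
        simp only [LowTempMem.pot₃]
        field_simp

/-- **`e^{κ(a)} ≤ a + 1/a + 6/a²` for `a ≥ 6`** — the second-order upper bound with the exact coefficient `1` of `1/a`
(the relaxation «no reversal, no unit square» has rate `a + 1/a + (4+o(1))/a²`).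
[cite: BeatonBousquetMelouDeGierDuminilCopinGuttmann2014, §3 (arXiv:1109.0358v5 pp. 9–10: «on the square lattice, μ(y) is asymptotic to y» — Rychlewski–Whittington 2011)]
[cite: BeatonGuttmannJensen2012Adsorption, §1 p. 2 (arXiv:1110.6695v1: «κ(α) is asymptotic to α»)] -/
theorem adsRate_le_add_inv_add_six_div_sq {a : ℝ} (ha : 6 ≤ a) : adsRate a ≤ a + 1 / a + 6 / a ^ 2 := by
  have ha0 : 0 < a := by linarith
  set Λ := a + 1 / a + 6 / a ^ 2 with hΛ
  have hΛ0 : 0 ≤ Λ := by positivity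
  set K : ℝ := 2 * a ^ 2 with hK
  have hKpos : 0 < K := by positivity
  have hK1 : Tendsto (fun n : ℕ => K ^ (1 / (n : ℝ))) atTop (𝓝 1) := by
    have := (tendsto_const_nhds (x := K)).rpow tendsto_one_div_atTop_nhds_zero_nat (Or.inl hKpos.ne')
    simpa using this
  have hup : Tendsto (fun n : ℕ => K ^ (1 / (n : ℝ)) * Λ) atTop (𝓝 Λ) := by
    simpa using hK1.mul_const Λ
  refine le_of_tendsto_of_tendsto (tendsto_adsRate ha0.le) hup ?_
  filter_upwards [eventually_ge_atTop 1] with n hn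
  calc (adsZ n a) ^ (1 / (n : ℝ)) ≤ (K * Λ ^ n) ^ (1 / (n : ℝ)) :=
        Real.rpow_le_rpow (adsZ_nonneg n ha0.le) (adsZ_le_exact ha n) (by positivity)
    _ = K ^ (1 / (n : ℝ)) * Λ := by
        rw [Real.mul_rpow hKpos.le (pow_nonneg hΛ0 _), one_div, Real.pow_rpow_inv_natCast hΛ0 (by omega)]

/-- **The exact second-order sandwich: `a + 1/a ≤ e^{κ(a)} ≤ a + 1/a + 6/a²` for `a ≥ 6`.**
[cite: BeatonBousquetMelouDeGierDuminilCopinGuttmann2014, §3 (arXiv:1109.0358v5 pp. 9–10: «on the square lattice, μ(y) is asymptotic to y» — Rychlewski–Whittington 2011)] -/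
theorem adsRate_mem_Icc_exact {a : ℝ} (ha : 6 ≤ a) : adsRate a ∈ Set.Icc (a + 1 / a) (a + 1 / a + 6 / a ^ 2) :=
  ⟨add_inv_le_adsRate (by linarith), adsRate_le_add_inv_add_six_div_sq ha⟩

/-- **`a · (e^{κ(a)} − a) → 1` as `a → ∞`**: the coefficient of `1/a` in the low-temperature expansion is exactly `1`
(one family of excursions survives at this order: the unit bumps `+e₀ +e₁ −e₀` ahead of the wall run).
[cite: BeatonBousquetMelouDeGierDuminilCopinGuttmann2014, §3 (arXiv:1109.0358v5 pp. 9–10: «on the square lattice, μ(y) is asymptotic to y» — Rychlewski–Whittington 2011)]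
[cite: JansevanRensburgWhittington2013, Corollary 1 and Theorem 5 (arXiv v4 p. 9): ratio asymptotics] -/
theorem tendsto_mul_adsRate_sub_self : Tendsto (fun a : ℝ => a * (adsRate a - a)) atTop (𝓝 1) := by
  have hup : Tendsto (fun a : ℝ => 1 + 6 * a⁻¹) atTop (𝓝 1) := by
    simpa using (tendsto_inv_atTop_zero.const_mul (6 : ℝ)).const_add (1 : ℝ)
  refine tendsto_of_tendsto_of_tendsto_of_le_of_le' tendsto_const_nhds hup ?_ ?_
  · filter_upwards [eventually_ge_atTop 3] with a ha
    have ha0 : 0 < a := by linarith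
    have h := add_inv_le_adsRate ha
    have : a * (a + 1 / a - a) = 1 := by field_simp; ring
    nlinarith [mul_le_mul_of_nonneg_left h ha0.le]
  · filter_upwards [eventually_ge_atTop 6] with a ha
    have ha0 : 0 < a := by linarith
    have h := adsRate_le_add_inv_add_six_div_sq ha
    have e : a * (a + 1 / a + 6 / a ^ 2 - a) = 1 + 6 * a⁻¹ := by field_simp; ring
    calc a * (adsRate a - a) ≤ a * (a + 1 / a + 6 / a ^ 2 - a) := by nlinarith
      _ = 1 + 6 * a⁻¹ := e

/-- **`log (1 + e^{−2α}) ≤ κ(α) − α ≤ log (1 + e^{−2α} + 6e^{−3α})` for `α ≥ log 6`**: `κ(α) = α + e^{−2α} + O(e^{−3α})`.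
[cite: BeatonBousquetMelouDeGierDuminilCopinGuttmann2014, §3 (arXiv:1109.0358v5 pp. 9–10: «on the square lattice, μ(y) is asymptotic to y» — Rychlewski–Whittington 2011)]
[cite: BeatonGuttmannJensen2012Adsorption, §1 p. 2 (arXiv:1110.6695v1: «κ(α) is asymptotic to α»)] -/
theorem adsFreeEnergy_sub_mem_Icc_exact {α : ℝ} (hα : Real.log 6 ≤ α) :
    adsFreeEnergy α - α ∈ Set.Icc (Real.log (1 + Real.exp (-2 * α)))
      (Real.log (1 + Real.exp (-2 * α) + 6 * Real.exp (-3 * α))) := by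
  set a := Real.exp α with ha_def
  have ha6 : 6 ≤ a := by
    rw [ha_def, ← Real.exp_log (by norm_num : (0 : ℝ) < 6)]
    exact Real.exp_le_exp.2 hα
  have ha0 : 0 < a := Real.exp_pos α
  have hpos := adsRate_pos ha0.le
  have he2 : Real.exp (-2 * α) = 1 / a ^ 2 := by
    rw [ha_def, ← Real.exp_nat_mul, one_div, ← Real.exp_neg]; ring_nf
  have he3 : Real.exp (-3 * α) = 1 / a ^ 3 := by
    rw [ha_def, ← Real.exp_nat_mul, one_div, ← Real.exp_neg]; ring_nf
  have elow : a * (1 + Real.exp (-2 * α)) = a + 1 / a := by rw [he2]; field_simp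
  have eup : a * (1 + Real.exp (-2 * α) + 6 * Real.exp (-3 * α)) = a + 1 / a + 6 / a ^ 2 := by
    rw [he2, he3]; field_simp
  have hκ : adsFreeEnergy α - α = Real.log (adsRate a / a) := by
    rw [adsFreeEnergy, Real.log_div hpos.ne' ha0.ne', ha_def, Real.log_exp]
  rw [hκ]
  constructor
  · refine Real.log_le_log (by positivity) ?_
    rw [le_div_iff₀ ha0, mul_comm, elow]
    exact add_inv_le_adsRate (by linarith)
  · refine Real.log_le_log (div_pos hpos ha0) ?_
    rw [div_le_iff₀ ha0, mul_comm, eup]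
    exact adsRate_le_add_inv_add_six_div_sq ha6

end Literature.Probability.RandomPlanarGeometry.SAW.Zd

end

namespace Literature.Probability.RandomPlanarGeometry.SAW.Zd

/-! ### The third order from below (rider): `a + 1/a + 1/a² − 3/a³ ≤ e^{κ(a)}` -/
/-- **`AdsorbedAbove a (a + 1/a + 1/a² − 3/a³)` for `a ≥ 3`** (the bump family at increment `u = 1/a + 1/a² − 3/a³`;
the family's own rate solves `λ = a + a²/(λ²(λ−1))` (wall step, or bump `+e₀ eᵏ −e₀` then a forced wall step), i.e.
`λ = a + 1/a + 1/a² − 2/a³ + O(1/a⁴)`).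
[cite: BeatonGuttmannJensen2012Adsorption, §1 (p. 2)] -/
theorem adsorbedAbove_third_order {a : ℝ} (ha : 3 ≤ a) : AdsorbedAbove a (a + 1 / a + 1 / a ^ 2 - 3 / a ^ 3) := by
  have ha0 : 0 < a := by linarith
  set u : ℝ := 1 / a + 1 / a ^ 2 - 3 / a ^ 3 with hu_def
  have key : a + 1 / a + 1 / a ^ 2 - 3 / a ^ 3 = a + u := by rw [hu_def]; ring
  rw [key]
  have hua : u * a ^ 3 = a ^ 2 + a - 3 := by rw [hu_def]; field_simp
  have hu0 : 0 ≤ u := by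
    by_contra h
    have : u * a ^ 3 < 0 := mul_neg_of_neg_of_pos (lt_of_not_ge h) (by positivity)
    rw [hua] at this
    nlinarith
  have e1 : (a + u) * a ^ 3 = a ^ 4 + a ^ 2 + a - 3 := by nlinarith [hua]
  have e2 : (a + u - 1) * a ^ 3 = a ^ 4 - a ^ 3 + a ^ 2 + a - 3 := by nlinarith [hua]
  obtain ⟨b, hb, hab⟩ : ∃ b : ℝ, 0 ≤ b ∧ a = b + 3 := ⟨a - 3, by linarith, by ring⟩
  refine adsorbedAbove_add_of_bump (by linarith) hu0 (by linarith) ?_ ?_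
  · have h6 : (0 : ℝ) < a ^ 6 := by positivity
    refine le_of_mul_le_mul_right ?_ h6
    have : (a + u) * (a + u - 1) * a ^ 6 = ((a + u) * a ^ 3) * ((a + u - 1) * a ^ 3) := by ring
    rw [this, e1, e2, hab]
    ring_nf
    nlinarith [hb, pow_nonneg hb 2, pow_nonneg hb 3, pow_nonneg hb 4, pow_nonneg hb 5, pow_nonneg hb 6,
      pow_nonneg hb 7, pow_nonneg hb 8]
  · have h12 : (0 : ℝ) < a ^ 12 := by positivity
    refine le_of_mul_le_mul_right ?_ h12
    have : (a + u) ^ 2 * (a + u - 1) * u * a ^ 12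
        = ((a + u) * a ^ 3) ^ 2 * ((a + u - 1) * a ^ 3) * (u * a ^ 3) := by ring
    rw [this, e1, e2, hua, hab]
    ring_nf
    nlinarith [hb, pow_nonneg hb 2, pow_nonneg hb 3, pow_nonneg hb 4, pow_nonneg hb 5, pow_nonneg hb 6,
      pow_nonneg hb 7, pow_nonneg hb 8, pow_nonneg hb 9, pow_nonneg hb 10, pow_nonneg hb 11, pow_nonneg hb 12,
      pow_nonneg hb 13, pow_nonneg hb 14]

/-- **`a + 1/a + 1/a² − 3/a³ ≤ e^{κ(a)}` for `a ≥ 3`**: with the tree's `a + 1/a + 6/a²` upper bound, the coefficient of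
`a⁻²` in the low-temperature expansion lies in `[1, 6]` (the relaxations' limits are `1` from below, `4` from above).
[cite: BeatonBousquetMelouDeGierDuminilCopinGuttmann2014, §3 (arXiv:1109.0358v5 pp. 9–10: «on the square lattice, μ(y) is asymptotic to y» — Rychlewski–Whittington 2011)] -/
theorem third_order_le_adsRate {a : ℝ} (ha : 3 ≤ a) : a + 1 / a + 1 / a ^ 2 - 3 / a ^ 3 ≤ adsRate a := by
  have ha0 : 0 < a := by linarith
  have hpos : 0 ≤ a + 1 / a + 1 / a ^ 2 - 3 / a ^ 3 := by
    have : 3 / a ^ 3 ≤ 1 / a ^ 2 := by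
      rw [div_le_div_iff₀ (by positivity) (by positivity)]; nlinarith
    have : 0 ≤ 1 / a := by positivity
    linarith
  exact le_adsRate_of_adsorbedAbove ha0.le hpos (adsorbedAbove_third_order ha)

end Literature.Probability.RandomPlanarGeometry.SAW.Zd
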